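import Literature.MathematicalPhysics.QuantumFieldTheory.Balaban1983to89.B6HolderLegPairTermsV1
import Literature.MathematicalPhysics.QuantumFieldTheory.Balaban1983to89.B6HolderPairInputsV1
import Literature.MathematicalPhysics.QuantumFieldTheory.Balaban1983to89.B6HolderPairGeometryV1
import Literature.MathematicalPhysics.QuantumFieldTheory.Balaban1983to89.B6Prop26HolderGradKLevelV1

/-!
# `Balaban1983to89.B6Ineq2137GradKLevelV1` — T. Bałaban, *Propagators and renormalization transformations for lattice gauge theories. II*,
# Commun. Math. Phys. **96** (1984) 223–250 [Balaban1984PropagatorsII], Prop. 2.6 p. 247, THE HÖLDER ENTRY **(2.137)₁ `‖ζ∇GJ‖_α` AT k LEVELS FOR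
# THE GENUINE `G = Δ_a⁻¹` ON THE V1 TORUS, HYPOTHESIS-FREE**: for every admissible pair of fine bonds `x, x′` (same direction,
# `|x − x′|_∞ ≤ L^{j(y(x))}`, `|x − x′|_∞ ≤ L^{j(y(x′))}`) and every `J` supported in the block `y′`,
# `|(∇_νGJ)(x) − (∇_νGJ)(x′)| ≤ O(1)·t^α·(L^{j(y(x))}η)·e^{−δ₃d_T(y(x),y′)}|J|`, `t = |x − x′|_∞/L^{j(y(x))}` — the first legs of the walk (2.141) now
# PROVED for every cube (this seat's `…B6HolderLegPairTermsV1`, `…B6HolderPairInputsV1`, `…B6HolderPairGeometryV1`) and fed to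
# `…B6Prop26HolderGradKLevelV1.prop26_2137_grad_kLevel_of_legs`; print's cut-off form `(‖ζ‖_α + |ζ|)` follows

statement-level skeleton of published theorems with citation tags; proofs where landed; nothing here is a claim about the Yang–Mills mass gap

PDF held: `paper:balaban1984-cmp96-propagators-rt-ii` (journal page = PDF page + 222), p. 247 [PDF 25] re-read this generation on the ×2 render
`b2b-balaban-ref1/pages/1984-cmp96-propagators-rt-II/1984-cmp96-propagators-rt-II-p025-x2.png`: *"Proposition 2.6. There exists a positive constant δ₃
depending on d and L only, such that … ‖ζ∇GJ‖_α, ‖ζG∇*J‖_α ≤ O(1)(Lʲη)^{1−α}(‖ζ‖^ξ_α + |ζ|)e^{−δ₃d(y,y′)}|J|, ξ = L^{−j} (2.137) for 0 ≤ α < 1,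
ζ ∈ C₀^∞(Δ̃(y)) (the cube Δ̃(y) for y ∈ Λ_j is a sum of 2^d unit cubes on the L^{−j}-scale, having y as a corner), supp J ⊂ Δ(y′), with the
constant O(1) depending on d, L and α (O(1) → ∞ if α → 1)"*; *"The operator G can be represented as G = … = Σ_ω h_{□₀}G_{□₀}h_{□₀}K_{□₁,□₂}⋯ (2.141)
and the series above is convergent in the norms appearing in the inequalities (2.136)–(2.140)."*; [4] = *… I*, CMP **95** (1984) (1.109) p. 35
(the Hölder quotient `|x − x′|^{−α}|A_μ(x) − A_μ(x′)|` over pairs `|x − x′| ≤ 1` at the scale `ξ`).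

CITATION HEADER (lean-in-tree rule) — WHAT IS REPRODUCED.  Phase-2 file of the `lit-balaban` typed skeleton (HOME `run/shared/lean/pub/lit-balaban/`),
seat **p22 gen 28** (free target under protocol G.5-34(d), TAKING line HOME/STATUS.md 2026-08-23T22:15Z, cc the B6 fold owner r03 and p38); SKELETON
row **B6.Prop2.6** (cells only; head unchanged, owner r03).  THE READING (as declared in `…B6Prop26HolderGradKLevelV1`): the Hölder quotient (1.109) at
ONE pair `(x, x′)` of fine bonds of the same direction is the value at `x` of the pair-difference operator `P_{x,x′}` applied to `∇_νGJ`; the output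
is localised at the block `y(x)` of the first point and the pair is ADMISSIBLE when `|x − x′|_∞ ≤ L^{j(y(x))}` and `|x − x′|_∞ ≤ L^{j(y(x′))}` (print:
`x, x′ ∈ Δ̃(y)`, the quotient at the scale `ξ = L^{−j}`), `t := |x − x′|_∞/L^{j(y(x))} ≤ 1`; UNITS: print's `(Lʲη)^{1−α}|x − x′|^α = (Lʲη)·t^α`, and
`Lʲη = (geomT D).len y·|c′|⁻¹` is the tree's covariant slot-2 prefactor.  Contents:
* §1 `hasMajorant_pairLeg_of_inactive` — on a cube where `h_□ = 0` at `x, x + e_ν, x′, x′ + e_ν` the pair entry of the first leg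
  `P_{x,x′}∇_ν(h_□G_□h_□)` vanishes;
* §2 **`holderLegs_kLevel`** — THE HÖLDER FIRST LEGS OF (2.141) FOR EVERY CUBE, HYPOTHESIS-FREE: there are `ρ_H > 0` and, for every `0 ≤ α < 1`,
  `C_H ≥ 0` (on `d, L, α` and the weight band) with `HasMajorant (P_{x,x′}·∇_ν·(h_□G_□h_□)) (1_{□̃}(y)·C_H·t^α·(L^{j(y)}|c′|⁻¹)·e^{−ρ_H d_T})` for
  every admissible pair — on an active cube the pair lies in the window of `T_□` and `|x − x′|_∞ ≤ L^{j₀+1}`, the geometry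
  `…B6HolderPairGeometryV1.pair_levels/pair_distT_le/pair_placement` discharges the level comparability, the block distance `d_T(y(x), y(x′)) ≤ (d+1)(L+1)`
  and the placement of `…B6HolderPairInputsV1.pairInputs_cube` (the pair inputs) and `…B6HolderLegPairTermsV1.holderLeg_pair_of_inputs` (the four-term
  product rule), and the displacement size `(d+1)|x − x′|_∞/(8S/5) ≤ (d+1)t^α` is absorbed;
* §3 **`ineq2137_grad_kLevel`** — (2.137)₁ AT k LEVELS FOR THE GENUINE `G`, NO DISPLAYED INPUT: `∃σ₁ > 0 ∀ 0 < σ ≤ σ₁ ∀ 0 < β ≤ 1 ∀ 0 ≤ α < 1 ∃ A ≥ 0,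
  M₂ > 0` such that on every V1 torus (`k ≥ 2`, `M_h = Lᵃ ≥ 8`, `M₂ ≤ L·M_h`, `R ≥ 2L²`, `P′ ≥ 5`, `L ≥ 5` odd, cubes placed, `c′ ≠ 0`, weights in
  the band) and every admissible pair: `HasMajorant (P_{x,x′}·∇_ν·onFun G) (A·t^α·(L^{j(y)}|c′|⁻¹)·e^{−δ₃d_T})` and, for `J` supported in the block
  `y′` with `|J| ≤ B`, `|(∇_νGJ)(x) − (∇_νGJ)(x′)| ≤ A·t^α·(L^{j(y(x))}|c′|⁻¹)·e^{−δ₃d_T(y(x),y′)}·B`, `δ₃ = delta3 β (2σ)`;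
* §4 **`ineq2137_grad_kLevel_cutoff`** — PRINT'S CUT-OFF FORM: for every `ζ` with `|ζ(x′)| ≤ Z₀`, `|ζ(x) − ζ(x′)| ≤ Z_d`:
  `|ζ(x)(∇_νGJ)(x) − ζ(x′)(∇_νGJ)(x′)| ≤ A·(Z₀t^α + Z_d)·(L^{j(y(x))}|c′|⁻¹)·e^{−δ₃d_T}·B` (`Z_d = ‖ζ‖_α t^α` gives print's `(‖ζ‖_α + |ζ|)`).
IMPORTS BY NAME, restating nothing; THEOREMS ONLY (no `def`, no `def … : Prop`, no new hypothesis); standard axioms.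

HONEST SCOPE / DIVERGENCES.  (1) One pair at a time, output at `y(x)`; admissibility is the symmetric pair condition above (print's `x, x′ ∈ Δ̃(y)`):
the one-sided condition `|x − x′|_∞ ≤ L^{j(y(x))}` alone does not localise `x′` near `y(x)` when `y(x′)` is a smaller block, and the bound with
`e^{−δ₃d_T(y(x),y′)}` is then not the printed statement.  (2) The second member `‖ζG∇*J‖_α` of (2.137) (a two-sided walk; p38's lane) and
(2.138)–(2.139) are NOT treated here.  (3) Setting of the imported k-level files: V1 torus, `k ≥ 2`, `M_h = Lᵃ ≥ 8`, one threshold `M₂ ≤ L·M_h`,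
`R ≥ 2L²`, `P′ ≥ 5`, odd `L ≥ 5`, top cubes placed, weights in the band (2.16); constants on `d, L, b₀, b₁, σ, β, α`, not optimised — print: *"O(1)
depending on d, L and α"*.  Integer torus, lattice units; nothing on d = 4 specifically or the continuum; NOT summit progress.  Unit `lit-balaban-p22`
(gen 28), 2026-08-24.
-/

open scoped BigOperators
open Finset

namespace Literature.MathematicalPhysics.QuantumFieldTheory.Balaban1983to89.B6Ineq2137GradKLevelV1

open LatticeFieldCalculus
open B4Reflection242 (boxDom)
open B6MultiLevelBoxOperator (N0 bigSide one_le_bigSide)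
open B6MultiLevelTorusOperator (TDomains)
open B6Cover236MultiLevelBlocks (cubes)
open B6Geom246MultiLevelTorus (geomT)
open B8Ineq192MultiLevelTorus (geomT_len)
open B6RandomWalk (HasMajorant hasMajorant_mono delta3 BlockSupp)
open B6Prop26Gluing (mulOp mulOp_apply ind ind_nonneg)
open B6Ineq2133TwoScaleV1 (onFun)
open B6GlobalChartV1 (PV domT blkV1)
open B6SectAOperatorsV1 (BondIdx)
open B6SectAVectorModelV1 (GE)
open B6Prop26KLevelSkeletonV1 (hB ST mem_ST pref pref_nonneg blkV1_mem_QT_of_hB_ne_zero)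
open B6Prop26KLevelSkeletonV2 (SbigT ST_subset_SbigT)
open B6InMajorantTransplant (InMajorant)
open B6CubeWindowV1 (Placed Gl GlobalBand band_le one_le_of_eight_le four_le_of_five_le j0 j0_le_level one_le_bigSide_real)
open B6Prop26KLevelAssemblyV1 (distT_nonneg)
open B6Partition118KLevelFineSizes (C1F C1F_nonneg)
open B6Eq292MemberTorusV1 (EC)
open B6GradLegKLevelV1 (DV DV_apply blkV1_mem_ST_of_hB_shift_ne_zero)
open B6HolderPairMemberV1 (pairOp pairOp_mul_apply hasMajorant_pairOp_mul pairDiff_le_of_hasMajorant)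
open B6HolderLegPairTermsV1 (holderLeg_pair_of_inputs)
open B6HolderPairInputsV1 (pairInputs_cube level_le_j0_succ_of_mem_ST)
open B6HolderPairGeometryV1 (pair_levels pair_distT_le pair_placement)
open B6Prop26HolderGradKLevelV1 (prop26_2137_grad_kLevel_of_legs prop26_2137_grad_kLevel_cutoff_of_legs)

noncomputable section

variable {d ℓ : ℕ} {hd : 1 ≤ d + 1} {hL : Odd (ℓ + 1) ∧ 1 < ℓ + 1} {m K : ℕ} {Mh k R : ℕ} {P' : Fin (d + 1) → ℕ}

/-! ## §1  An inactive cube: the pair entry of the first leg vanishes -/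

section Inactive

open Classical in
/-- **ON A CUBE WHERE `h_□` VANISHES AT `x, x + e_ν, x′, x′ + e_ν` THE PAIR ENTRY OF THE FIRST LEG VANISHES**: both values
`∇_ν(h_□G_□h_□μ)(x) = c′(h_□(x+e_ν)(G_□h_□μ)(x+e_ν) − h_□(x)(G_□h_□μ)(x))` and the same at `x′` are zero, so `P_{x,x′}∇_ν(h_□G_□h_□)` has every
nonnegative majorant. [cite: Balaban1984PropagatorsII, (2.141) p.247, (2.91)–(2.92) p.239 (supp h_□); Balaban1984PropagatorsI, (1.109) p.35; bookkeeping] -/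
theorem hasMajorant_pairLeg_of_inactive (hN : ∀ μ, N0 ℓ Mh k P' μ = (PV d ℓ m K hd hL).sitesPerDir 0) (D : TDomains d ℓ Mh k P' R)
    (hk : k ≤ m + K) (hMh1 : 1 ≤ Mh) (hP4 : ∀ μ, 4 ≤ P' μ) {a : ℕ} (hMha : Mh = (ℓ + 1) ^ a) (c : ↥(cubes D.toDomains)) {a₀ a₁ : ℝ}
    (ha₁ : a₀ ≤ a₁) (hpl : Placed ℓ k P' c.1) (w : BondIdx (domT hN D hk) → ℝ) (cf : ℝ) (ν : Fin (d + 1)) {x x' : PBond (PV d ℓ m K hd hL) 0}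
    (h0 : hB hN D c x = 0) (h1 : hB hN D c ⟨x.src.shift ν, x.dir⟩ = 0) (h0' : hB hN D c x' = 0) (h1' : hB hN D c ⟨x'.src.shift ν, x'.dir⟩ = 0)
    {Kf : (geomT D).Site → (geomT D).Site → ℝ} (hK : ∀ y y', 0 ≤ Kf y y') :
    HasMajorant (g := geomT D) (blkV1 hN D)
      (pairOp x x' * DV (P := PV d ℓ m K hd hL) ν cf * (mulOp (hB hN D c) * Gl hN hk hMh1 hP4 hMha c ha₁ hpl w cf * mulOp (hB hN D c))) Kf := by
  set W := mulOp (hB hN D c) * Gl hN hk hMh1 hP4 hMha c ha₁ hpl w cf * mulOp (hB hN D c) with hW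
  have hv : ∀ (μ : PBond (PV d ℓ m K hd hL) 0 → ℝ) (b : PBond (PV d ℓ m K hd hL) 0), hB hN D c b = 0 → hB hN D c ⟨b.src.shift ν, b.dir⟩ = 0 →
      (DV (P := PV d ℓ m K hd hL) ν cf * W) μ b = 0 := by
    intro μ b hb0 hb1
    rw [Module.End.mul_apply, DV_apply, hW, Module.End.mul_apply, Module.End.mul_apply, mulOp_apply, mulOp_apply, hb0, hb1]
    ring
  rw [mul_assoc]
  refine hasMajorant_pairOp_mul (g := geomT D) (blkV1 hN D) x x' hK fun y' μ B hμ => ?_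
  rw [hv μ x h0 h1, hv μ x' h0' h1', sub_zero, abs_zero]
  exact mul_nonneg (hK _ _) hμ.nonneg

end Inactive

/-! ## §2  The Hölder first legs of (2.141) for every cube, hypothesis-free -/

section Legs

open Classical in
/-- **THE HÖLDER FIRST LEGS OF THE WALK (2.141) FOR `∇_νG`, FOR EVERY CUBE AND EVERY ADMISSIBLE PAIR, NO DISPLAYED INPUT** (`L ≥ 5`): there are
`ρ_H > 0` and, for every `0 ≤ α < 1`, `C_H ≥ 0` (on `d, L, α` and the weight band only) such that on every V1 torus with `M_h = Lᵃ ≥ 8`, `R ≥ 2L²`,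
`P′ ≥ 5`, for every placed cube `□`, weights, `c′ ≠ 0`, direction `ν` and fine bonds `x, x′` of the same direction with `|x − x′|_∞ ≤ L^{j(y(x))}`,
`|x − x′|_∞ ≤ L^{j(y(x′))}`:
`HasMajorant (P_{x,x′}·∇_ν·(h_□G_□h_□)) (1_{□̃}(y)·C_H·t^α·(L^{j(y)}|c′|⁻¹)·e^{−ρ_H d_T(y,y′)})`, `t = |x − x′|_∞/L^{j(y(x))}` — the legs hypothesis of
`…B6Prop26HolderGradKLevelV1.prop26_2137_grad_kLevel_of_legs` with `Pw(y) = t^α·(L^{j(y)}|c′|⁻¹)`, i.e. print's `O(1)(Lʲη)^{1−α}|x − x′|^α e^{−δd}`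
for the member inequality (2.133)/(1.111) dressed with `h_□`.
[cite: Balaban1984PropagatorsII, Prop. 2.6 (2.137) p.247, (2.141) p.247, (2.133) p.247, (2.92) p.239; Balaban1984PropagatorsI, (1.109)–(1.111) p.35] -/
theorem holderLegs_kLevel (d ℓ : ℕ) (hd : 1 ≤ d + 1) (hL : Odd (ℓ + 1) ∧ 1 < ℓ + 1) {b₀ b₁ : ℝ} (hb₀ : 0 < b₀) (hb₁ : b₀ ≤ b₁) :
    ∃ ρH : ℝ, 0 < ρH ∧ ∀ α : ℝ, 0 ≤ α → α < 1 → ∃ CH : ℝ, 0 ≤ CH ∧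
    ∀ (m K : ℕ) {Mh k R : ℕ} {P' : Fin (d + 1) → ℕ}
      (hN : ∀ μ, N0 ℓ Mh k P' μ = (PV d ℓ m K hd hL).sitesPerDir 0) (D : TDomains d ℓ Mh k P' R) (hk : k ≤ m + K)
      {a : ℕ} (hMha : Mh = (ℓ + 1) ^ a) (hM8 : 8 ≤ Mh) (_ : 2 * (ℓ + 1) ^ 2 ≤ R) (hP5 : ∀ μ, 5 ≤ P' μ) (_ : 4 ≤ ℓ)
      (c : ↥(cubes D.toDomains)) (hpl : Placed ℓ k P' c.1) (w : BondIdx (domT hN D hk) → ℝ) {cf : ℝ} (_ : cf ≠ 0)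
      (ν : Fin (d + 1)) (x x' : PBond (PV d ℓ m K hd hL) 0), x.dir = x'.dir →
      supDist x.src x'.src ≤ (ℓ + 1) ^ (blkV1 hN D x).1.1 → supDist x.src x'.src ≤ (ℓ + 1) ^ (blkV1 hN D x').1.1 →
      HasMajorant (g := geomT D) (blkV1 hN D)
        (pairOp x x' * DV (P := PV d ℓ m K hd hL) ν cf *
          (mulOp (hB hN D c) *
            Gl hN hk (one_le_of_eight_le hM8) (four_le_of_five_le hP5) hMha c (band_le (d := d) (ℓ := ℓ) hb₀ hb₁) hpl w cf *
            mulOp (hB hN D c)))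
        (fun y y' => ind (SbigT D (one_le_of_eight_le hM8) (four_le_of_five_le hP5) c) y *
          (CH * ((((supDist x.src x'.src : ℕ) : ℝ) / (((ℓ + 1 : ℕ) : ℝ)) ^ (blkV1 hN D x).1.1) ^ α * ((geomT D).len y * |cf|⁻¹)) *
            Real.exp (-(ρH * (geomT D).dist y y')))) := by
  have ha₀ : (0 : ℝ) < b₀ / ((ℓ + 1 : ℕ) : ℝ) := by positivity
  obtain ⟨ρ₀, hρ₀, C₀, hC₀, hE⟩ := holderLeg_pair_of_inputs d ℓ hd hL ha₀ (band_le (d := d) (ℓ := ℓ) hb₀ hb₁)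
  obtain ⟨ρ', hρ', ρ₁, hρ₁, hH⟩ := pairInputs_cube d ℓ hd hL ha₀ (band_le (d := d) (ℓ := ℓ) hb₀ hb₁)
  refine ⟨min ρ₀ ρ', lt_min hρ₀ hρ', fun α hα0 hα1 => ?_⟩
  obtain ⟨CP, hCP, hH'⟩ := hH α hα0 hα1
  set Λ : ℝ := ((ℓ + 1 : ℕ) : ℝ) with hΛ
  have hΛ1 : (1 : ℝ) ≤ Λ := by rw [hΛ]; exact_mod_cast Nat.succ_pos ℓ
  set r₀ : ℝ := ((d : ℝ) + 1) * (((ℓ : ℝ) + 1) + 1) with hr₀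
  have hr₀0 : 0 ≤ r₀ := by positivity
  have hC1 := C1F_nonneg d ℓ
  refine ⟨Λ ^ 2 * ((1 + C1F d ℓ) * (CP * Real.exp (ρ₁ * r₀) * Λ ^ 2) + ((d : ℝ) + 1) * C₀), by positivity, ?_⟩
  intro m K Mh k R P' hN D hk a hMha hM8 hR2 hP5 hℓ c hpl w cf hcf ν x x' hdir hs1 hs2
  have hMh1 : 1 ≤ Mh := one_le_of_eight_le hM8
  have hP4 : ∀ μ, 4 ≤ P' μ := four_le_of_five_le hP5
  have hMh : 2 ≤ Mh := le_trans (by norm_num) hM8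
  have hR : 2 * (ℓ + 1) ≤ R := le_trans (by nlinarith : 2 * (ℓ + 1) ≤ 2 * (ℓ + 1) ^ 2) hR2
  have hL1 : 1 ≤ ℓ + 1 := Nat.succ_pos ℓ
  set s : ℝ := ((supDist x.src x'.src : ℕ) : ℝ) with hs
  have hs0 : 0 ≤ s := Nat.cast_nonneg _
  set t : ℝ := s / Λ ^ (blkV1 hN D x).1.1 with ht
  have hJx : (0 : ℝ) < Λ ^ (blkV1 hN D x).1.1 := by positivity
  have ht0 : 0 ≤ t := by positivity
  have ht1 : t ≤ 1 := by rw [ht, div_le_one hJx, hs, hΛ]; exact_mod_cast hs1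
  have htα0 : 0 ≤ t ^ α := Real.rpow_nonneg ht0 _
  -- the kernel is nonnegative
  have hKnn : ∀ y y' : (geomT D).Site, 0 ≤ ind (SbigT D hMh1 hP4 c) y *
      (Λ ^ 2 * ((1 + C1F d ℓ) * (CP * Real.exp (ρ₁ * r₀) * Λ ^ 2) + ((d : ℝ) + 1) * C₀) * (t ^ α * ((geomT D).len y * |cf|⁻¹)) *
        Real.exp (-(min ρ₀ ρ' * (geomT D).dist y y'))) := by
    intro y y'
    have := ind_nonneg (SbigT D hMh1 hP4 c) y
    have : 0 ≤ (geomT D).len y * |cf|⁻¹ := by rw [geomT_len]; positivity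
    positivity
  by_cases hact : hB hN D c x ≠ 0 ∨ hB hN D c ⟨x.src.shift ν, x.dir⟩ ≠ 0 ∨ hB hN D c x' ≠ 0 ∨ hB hN D c ⟨x'.src.shift ν, x'.dir⟩ ≠ 0
  · -- ACTIVE CUBE: the active point's block is in `□⁺`, so `|x − x′|_∞ ≤ L^{j₀+1}`
    have hdist : supDist x.src x'.src ≤ (ℓ + 1) ^ (j0 hMh1 hP4 c + 1) := by
      rcases hact with h | h | h | h
      · exact hs1.trans (Nat.pow_le_pow_right hL1 (level_le_j0_succ_of_mem_ST hMh hR2 hL c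
          ((mem_ST D hMh1 hP4 c _).2 (blkV1_mem_QT_of_hB_ne_zero hN D hMh hR hP4 c h))))
      · exact hs1.trans (Nat.pow_le_pow_right hL1 (level_le_j0_succ_of_mem_ST hMh hR2 hL c
          (blkV1_mem_ST_of_hB_shift_ne_zero hN hMh1 hP4 c hM8 hR hP5 ν h)))
      · exact hs2.trans (Nat.pow_le_pow_right hL1 (level_le_j0_succ_of_mem_ST hMh hR2 hL c
          ((mem_ST D hMh1 hP4 c _).2 (blkV1_mem_QT_of_hB_ne_zero hN D hMh hR hP4 c h))))
      · exact hs2.trans (Nat.pow_le_pow_right hL1 (level_le_j0_succ_of_mem_ST hMh hR2 hL c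
          (blkV1_mem_ST_of_hB_shift_ne_zero hN hMh1 hP4 c hM8 hR hP5 ν h)))
    -- the geometry of the pair: levels in `{j₀, j₀+1}`, `d_T(y(x), y(x′)) ≤ r₀`, placement
    obtain ⟨⟨hjx, hxj⟩, ⟨hjx', hx'j⟩⟩ := pair_levels hN D hk hMha c hM8 hR2 hpl ν hact hdist
    have hdT := pair_distT_le hN D hk hMha c hM8 hR2 hpl ν hact hdist
    have hgeo : blkV1 hN D x' ∈ ST D hMh1 hP4 c → blkV1 hN D x ∈ SbigT D hMh1 hP4 c :=
      fun h => pair_placement hN D hk hMha c hM8 hR2 hpl ν hact hdist h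
    -- the pair inputs (member Hölder through the window, or two single points) and the four-term first leg
    obtain ⟨hA, hC⟩ := hH' m K hN D hk hMh1 hP4 hMha hM8 hR2 hP5 hℓ c hpl w cf ν r₀ hr₀0 x x' hdir hs1 hs2 hact
      (by omega) (by omega) hdT
    have hτ : 0 ≤ CP * Real.exp (ρ₁ * r₀) * (Λ ^ 2 * t ^ α) := by positivity
    have hleg := hE m K hN D hk hMh1 hP4 hMha hM8 hR2 hP5 hℓ c hpl w hcf ν x x' hdir (by omega) hgeo _ _ ρ' hτ hτ hρ' hA hC
    refine hasMajorant_mono (g := geomT D) _ hleg fun y y' => ?_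
    -- the displacement size `(d+1)|x − x′|_∞/(8S/5) ≤ (d+1)t^α`
    have hS1 := one_le_bigSide_real (ℓ := ℓ) hMh1 c.1.1
    have hσ : ((d : ℝ) + 1) * s / (8 / 5 * (bigSide ℓ Mh c.1.1 : ℝ)) ≤ ((d : ℝ) + 1) * t ^ α := by
      have hS0 : (0 : ℝ) < 8 / 5 * (bigSide ℓ Mh c.1.1 : ℝ) := by positivity
      rw [mul_div_assoc]
      refine mul_le_mul_of_nonneg_left ?_ (by positivity)
      rw [div_le_iff₀ hS0]
      have htt : t ≤ t ^ α := by
        rcases ht0.eq_or_lt with h | h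
        · rw [← h]; exact Real.rpow_nonneg le_rfl _
        · have h' := Real.rpow_le_rpow_of_exponent_ge h ht1 hα1.le
          rwa [Real.rpow_one] at h'
      have hpow : Λ ^ (blkV1 hN D x).1.1 ≤ (bigSide ℓ Mh c.1.1 : ℝ) := by
        have hj := (j0_le_level (D := D) (hMh1 := hMh1) (hP4 := hP4) (c := c) hL hR2).1
        have h1 : Λ ^ (blkV1 hN D x).1.1 ≤ Λ ^ (c.1.1 + 1) := pow_le_pow_right₀ hΛ1 (by omega)
        have h2 : Λ ^ (c.1.1 + 1) ≤ (bigSide ℓ Mh c.1.1 : ℝ) := by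
          unfold bigSide; rw [hΛ]; push_cast
          have hM1 : (1 : ℝ) ≤ Mh := by exact_mod_cast hMh1
          have hp : (0 : ℝ) ≤ ((ℓ : ℝ) + 1) ^ (c.1.1 + 1) := by positivity
          nlinarith
        exact h1.trans h2
      have es : s = t * Λ ^ (blkV1 hN D x).1.1 := by rw [ht]; field_simp
      rw [es]
      calc t * Λ ^ (blkV1 hN D x).1.1 ≤ t ^ α * (bigSide ℓ Mh c.1.1 : ℝ) := mul_le_mul htt hpow hJx.le htα0
        _ ≤ t ^ α * (8 / 5 * (bigSide ℓ Mh c.1.1 : ℝ)) := mul_le_mul_of_nonneg_left (by linarith) htα0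
    -- compare the kernels
    have hq : 0 ≤ (geomT D).len y * |cf|⁻¹ := by rw [geomT_len]; positivity
    have hi := ind_nonneg (SbigT D hMh1 hP4 c) y
    have he := Real.exp_nonneg (-(min ρ₀ ρ' * (geomT D).dist y y'))
    have h1 : ((d : ℝ) + 1) * s / (8 / 5 * (bigSide ℓ Mh c.1.1 : ℝ)) * C₀ ≤ ((d : ℝ) + 1) * t ^ α * C₀ :=
      mul_le_mul_of_nonneg_right hσ hC₀
    have hcore : Λ ^ 2 * (CP * Real.exp (ρ₁ * r₀) * (Λ ^ 2 * t ^ α) + C1F d ℓ * (CP * Real.exp (ρ₁ * r₀) * (Λ ^ 2 * t ^ α)) +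
        ((d : ℝ) + 1) * s / (8 / 5 * (bigSide ℓ Mh c.1.1 : ℝ)) * C₀) ≤
        Λ ^ 2 * ((1 + C1F d ℓ) * (CP * Real.exp (ρ₁ * r₀) * Λ ^ 2) + ((d : ℝ) + 1) * C₀) * t ^ α := by
      have hΛ2 : (0 : ℝ) ≤ Λ ^ 2 := by positivity
      calc Λ ^ 2 * (CP * Real.exp (ρ₁ * r₀) * (Λ ^ 2 * t ^ α) + C1F d ℓ * (CP * Real.exp (ρ₁ * r₀) * (Λ ^ 2 * t ^ α)) +
            ((d : ℝ) + 1) * s / (8 / 5 * (bigSide ℓ Mh c.1.1 : ℝ)) * C₀)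
          = Λ ^ 2 * ((1 + C1F d ℓ) * (CP * Real.exp (ρ₁ * r₀) * Λ ^ 2) * t ^ α +
              ((d : ℝ) + 1) * s / (8 / 5 * (bigSide ℓ Mh c.1.1 : ℝ)) * C₀) := by ring
        _ ≤ Λ ^ 2 * ((1 + C1F d ℓ) * (CP * Real.exp (ρ₁ * r₀) * Λ ^ 2) * t ^ α + ((d : ℝ) + 1) * t ^ α * C₀) :=
            mul_le_mul_of_nonneg_left (by linarith) hΛ2
        _ = Λ ^ 2 * ((1 + C1F d ℓ) * (CP * Real.exp (ρ₁ * r₀) * Λ ^ 2) + ((d : ℝ) + 1) * C₀) * t ^ α := by ring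
    calc ind (SbigT D hMh1 hP4 c) y * (Λ ^ 2 * (CP * Real.exp (ρ₁ * r₀) * (Λ ^ 2 * t ^ α) +
          C1F d ℓ * (CP * Real.exp (ρ₁ * r₀) * (Λ ^ 2 * t ^ α)) + ((d : ℝ) + 1) * s / (8 / 5 * (bigSide ℓ Mh c.1.1 : ℝ)) * C₀) *
          ((geomT D).len y * |cf|⁻¹) * Real.exp (-(min ρ₀ ρ' * (geomT D).dist y y')))
        = ind (SbigT D hMh1 hP4 c) y * ((Λ ^ 2 * (CP * Real.exp (ρ₁ * r₀) * (Λ ^ 2 * t ^ α) +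
          C1F d ℓ * (CP * Real.exp (ρ₁ * r₀) * (Λ ^ 2 * t ^ α)) + ((d : ℝ) + 1) * s / (8 / 5 * (bigSide ℓ Mh c.1.1 : ℝ)) * C₀)) *
          (((geomT D).len y * |cf|⁻¹) * Real.exp (-(min ρ₀ ρ' * (geomT D).dist y y')))) := by ring
      _ ≤ ind (SbigT D hMh1 hP4 c) y * ((Λ ^ 2 * ((1 + C1F d ℓ) * (CP * Real.exp (ρ₁ * r₀) * Λ ^ 2) + ((d : ℝ) + 1) * C₀) * t ^ α) *
          (((geomT D).len y * |cf|⁻¹) * Real.exp (-(min ρ₀ ρ' * (geomT D).dist y y')))) :=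
        mul_le_mul_of_nonneg_left (mul_le_mul_of_nonneg_right hcore (mul_nonneg hq he)) hi
      _ = ind (SbigT D hMh1 hP4 c) y * (Λ ^ 2 * ((1 + C1F d ℓ) * (CP * Real.exp (ρ₁ * r₀) * Λ ^ 2) + ((d : ℝ) + 1) * C₀) *
          (t ^ α * ((geomT D).len y * |cf|⁻¹)) * Real.exp (-(min ρ₀ ρ' * (geomT D).dist y y'))) := by ring
  · -- INACTIVE CUBE: the entry vanishes
    push Not at hact
    obtain ⟨h0, h1, h0', h1'⟩ := hact
    exact hasMajorant_pairLeg_of_inactive hN D hk hMh1 hP4 hMha c _ hpl w cf ν h0 h1 h0' h1' hKnn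

end Legs

/-! ## §3  (2.137)₁ at k levels for the genuine `G`, hypothesis-free -/

section Main

open Classical in
/-- **PROPOSITION 2.6 (2.137)₁ `‖ζ∇GJ‖_α` AT k LEVELS FOR THE GENUINE `G = Δ_a⁻¹` ON THE V1 TORUS — NO DISPLAYED INPUT.** For every weight band
`[b₀, b₁]` there is `σ₁ > 0` such that for all `0 < σ ≤ σ₁`, `0 < β ≤ 1`, `0 ≤ α < 1` there are `A ≥ 0`, `M₂ > 0` (on `d, L, b₀, b₁, σ, β, α`) with:
on every V1 global torus with `k ≥ 2`, `M_h = Lᵃ ≥ 8`, `M₂ ≤ L·M_h`, `R ≥ 2L²`, `P′ ≥ 5`, `L ≥ 5`, all cubes placed, `c′ ≠ 0`, weights in the band,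
for every direction `ν` and every ADMISSIBLE pair of fine bonds `(x, x′)` (same direction, `|x − x′|_∞ ≤ L^{j(y(x))}`, `|x − x′|_∞ ≤ L^{j(y(x′))}`),
with `t := |x − x′|_∞/L^{j(y(x))}`: `HasMajorant (P_{x,x′}·∇_ν·onFun G) (A·t^α·(L^{j(y)}·|c′|⁻¹)·e^{−δ₃d_T(y,y′)})` and, for every `J` supported in
the block `y′` with `|J| ≤ B`: `|(∇^η_νGJ)(x) − (∇^η_νGJ)(x′)| ≤ A·t^α·(L^{j(y(x))}·|c′|⁻¹)·e^{−δ₃d_T(y(x),y′)}·B`, `δ₃ = delta3 β (2σ)` — print's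
`|x − x′|^{−α}|(∇GJ)(x) − (∇GJ)(x′)| ≤ O(1)(Lʲη)^{1−α}e^{−δ₃d(y,y′)}|J|` for `x, x′ ∈ Δ̃(y)` in the declared units.
[cite: Balaban1984PropagatorsII, Prop. 2.6 (2.137) p.247 («‖ζ∇GJ‖_α ≤ O(1)(Lʲη)^{1−α}(‖ζ‖^ξ_α+|ζ|)e^{−δ₃d(y,y′)}|J|»), (2.141) p.247, (2.66) p.234; Balaban1984PropagatorsI, (1.109) p.35] -/
theorem ineq2137_grad_kLevel (d ℓ : ℕ) (hd : 1 ≤ d + 1) (hL : Odd (ℓ + 1) ∧ 1 < ℓ + 1) {b₀ b₁ : ℝ} (hb₀ : 0 < b₀) (hb₁ : b₀ ≤ b₁) :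
    ∃ σ₁ : ℝ, 0 < σ₁ ∧ ∀ (σ : ℝ), 0 < σ → σ ≤ σ₁ → ∀ (β : ℝ), 0 < β → β ≤ 1 → ∀ (α : ℝ), 0 ≤ α → α < 1 →
    ∃ A M₂ : ℝ, 0 ≤ A ∧ 0 < M₂ ∧
    ∀ (m K : ℕ) {Mh k R : ℕ} {P' : Fin (d + 1) → ℕ}
      (hN : ∀ μ, N0 ℓ Mh k P' μ = (PV d ℓ m K hd hL).sitesPerDir 0) (D : TDomains d ℓ Mh k P' R) (hk : k ≤ m + K) (_ : 2 ≤ k)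
      {a : ℕ} (hMha : Mh = (ℓ + 1) ^ a) (hM8 : 8 ≤ Mh) (_ : 2 * (ℓ + 1) ^ 2 ≤ R) (hP5 : ∀ μ, 5 ≤ P' μ) (_ : 4 ≤ ℓ)
      (hpl : ∀ c : ↥(cubes D.toDomains), Placed ℓ k P' c.1) (_ : M₂ ≤ ((ℓ : ℝ) + 1) * Mh)
      {cf : ℝ} (hcf : cf ≠ 0) {w : BondIdx (domT hN D hk) → ℝ} (hw : ∀ i, 0 < w i) (_ : GlobalBand b₀ b₁ cf w)
      (ν : Fin (d + 1)) (x x' : PBond (PV d ℓ m K hd hL) 0), x.dir = x'.dir →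
      supDist x.src x'.src ≤ (ℓ + 1) ^ (blkV1 hN D x).1.1 → supDist x.src x'.src ≤ (ℓ + 1) ^ (blkV1 hN D x').1.1 →
      HasMajorant (g := geomT D) (blkV1 hN D) (pairOp x x' * DV (P := PV d ℓ m K hd hL) ν cf * onFun (GE (domT hN D hk) hcf hw))
          (fun y y' => A * ((((supDist x.src x'.src : ℕ) : ℝ) / (((ℓ + 1 : ℕ) : ℝ)) ^ (blkV1 hN D x).1.1) ^ α *
            ((geomT D).len y * |cf|⁻¹)) * Real.exp (-(delta3 β (2 * σ) * (geomT D).dist y y'))) ∧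
      ∀ (y' : (geomT D).Site) (μ : PBond (PV d ℓ m K hd hL) 0 → ℝ) (B : ℝ), BlockSupp (blkV1 hN D) μ y' B →
        |(DV (P := PV d ℓ m K hd hL) ν cf * onFun (GE (domT hN D hk) hcf hw)) μ x - (DV (P := PV d ℓ m K hd hL) ν cf * onFun (GE (domT hN D hk) hcf hw)) μ x'| ≤
          A * ((((supDist x.src x'.src : ℕ) : ℝ) / (((ℓ + 1 : ℕ) : ℝ)) ^ (blkV1 hN D x).1.1) ^ α *
            ((geomT D).len (blkV1 hN D x) * |cf|⁻¹)) * Real.exp (-(delta3 β (2 * σ) * (geomT D).dist (blkV1 hN D x) y')) * B := by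
  obtain ⟨ρH, hρH, hlegs⟩ := holderLegs_kLevel d ℓ hd hL hb₀ hb₁
  obtain ⟨σ₁, hσ₁, -, h⟩ := prop26_2137_grad_kLevel_of_legs d ℓ hd hL hb₀ hb₁ hρH
  refine ⟨σ₁, hσ₁, fun σ hσ hσ1 β hβ hβ1 α hα0 hα1 => ?_⟩
  obtain ⟨A, M₂, hA, hM₂, h2⟩ := h σ hσ hσ1 β hβ hβ1
  obtain ⟨CH, hCH, hlegs'⟩ := hlegs α hα0 hα1
  refine ⟨A * CH, M₂, mul_nonneg hA hCH, hM₂, ?_⟩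
  intro m K Mh k R P' hN D hk hk2 a hMha hM8 hR2 hP5 hℓ hpl hM cf hcf w hw hwb ν x x' hdir hs1 hs2
  have hPw : ∀ y : (geomT D).Site, 0 ≤ (((supDist x.src x'.src : ℕ) : ℝ) / (((ℓ + 1 : ℕ) : ℝ)) ^ (blkV1 hN D x).1.1) ^ α *
      ((geomT D).len y * |cf|⁻¹) := fun y => by
    have : 0 ≤ (geomT D).len y * |cf|⁻¹ := by rw [geomT_len]; positivity
    exact mul_nonneg (Real.rpow_nonneg (by positivity) _) this
  exact h2 m K hN D hk hk2 hMha hM8 hR2 hP5 hℓ hpl hM hcf hw hwb ν x x' CH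
    (fun y => (((supDist x.src x'.src : ℕ) : ℝ) / (((ℓ + 1 : ℕ) : ℝ)) ^ (blkV1 hN D x).1.1) ^ α * ((geomT D).len y * |cf|⁻¹)) hCH hPw
    (fun c => hlegs' m K hN D hk hMha hM8 hR2 hP5 hℓ c (hpl c) w hcf ν x x' hdir hs1 hs2)

end Main

/-! ## §4  Print's cut-off form `(‖ζ‖_α + |ζ|)` -/

section Cutoff

open Classical in
/-- **PROPOSITION 2.6 (2.137)₁ IN PRINT'S CUT-OFF FORM, AT k LEVELS FOR THE GENUINE `G`, NO DISPLAYED INPUT.** For the weight band there is `σ₁ > 0`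
and for all `0 < σ ≤ σ₁`, `0 < β ≤ 1`, `0 ≤ α < 1` constants `A ≥ 0`, `M₂ > 0` such that on every admissible V1 torus (binders of §3), for every
direction `ν`, every admissible pair `(x, x′)` (`t := |x − x′|_∞/L^{j(y(x))}`), every cut-off `ζ` on the fine bonds with `|ζ(x′)| ≤ Z₀`,
`|ζ(x) − ζ(x′)| ≤ Z_d`, and every `J` supported in the block `y′` with `|J| ≤ B`:
`|ζ(x)(∇_νGJ)(x) − ζ(x′)(∇_νGJ)(x′)| ≤ A·(Z₀·t^α + Z_d)·(L^{j(y(x))}·|c′|⁻¹)·e^{−δ₃d_T(y(x),y′)}·B` — with `Z_d = ‖ζ‖^ξ_α·t^α` this is print's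
`O(1)(Lʲη)^{1−α}|x − x′|^α(‖ζ‖^ξ_α + |ζ|)e^{−δ₃d(y,y′)}|J|`.
[cite: Balaban1984PropagatorsII, Prop. 2.6 (2.136)–(2.137) p.247, (2.141) p.247; Balaban1984PropagatorsI, (1.109), (1.111) p.35] -/
theorem ineq2137_grad_kLevel_cutoff (d ℓ : ℕ) (hd : 1 ≤ d + 1) (hL : Odd (ℓ + 1) ∧ 1 < ℓ + 1) {b₀ b₁ : ℝ} (hb₀ : 0 < b₀) (hb₁ : b₀ ≤ b₁) :
    ∃ σ₁ : ℝ, 0 < σ₁ ∧ ∀ (σ : ℝ), 0 < σ → σ ≤ σ₁ → ∀ (β : ℝ), 0 < β → β ≤ 1 → ∀ (α : ℝ), 0 ≤ α → α < 1 →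
    ∃ A M₂ : ℝ, 0 ≤ A ∧ 0 < M₂ ∧
    ∀ (m K : ℕ) {Mh k R : ℕ} {P' : Fin (d + 1) → ℕ}
      (hN : ∀ μ, N0 ℓ Mh k P' μ = (PV d ℓ m K hd hL).sitesPerDir 0) (D : TDomains d ℓ Mh k P' R) (hk : k ≤ m + K) (_ : 2 ≤ k)
      {a : ℕ} (hMha : Mh = (ℓ + 1) ^ a) (hM8 : 8 ≤ Mh) (_ : 2 * (ℓ + 1) ^ 2 ≤ R) (hP5 : ∀ μ, 5 ≤ P' μ) (_ : 4 ≤ ℓ)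
      (hpl : ∀ c : ↥(cubes D.toDomains), Placed ℓ k P' c.1) (_ : M₂ ≤ ((ℓ : ℝ) + 1) * Mh)
      {cf : ℝ} (hcf : cf ≠ 0) {w : BondIdx (domT hN D hk) → ℝ} (hw : ∀ i, 0 < w i) (_ : GlobalBand b₀ b₁ cf w)
      (ν : Fin (d + 1)) (x x' : PBond (PV d ℓ m K hd hL) 0), x.dir = x'.dir →
      supDist x.src x'.src ≤ (ℓ + 1) ^ (blkV1 hN D x).1.1 → supDist x.src x'.src ≤ (ℓ + 1) ^ (blkV1 hN D x').1.1 →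
      ∀ (ζ : PBond (PV d ℓ m K hd hL) 0 → ℝ) (Z₀ Zd : ℝ), |ζ x'| ≤ Z₀ → |ζ x - ζ x'| ≤ Zd →
      ∀ (y' : (geomT D).Site) (μ : PBond (PV d ℓ m K hd hL) 0 → ℝ) (B : ℝ), BlockSupp (blkV1 hN D) μ y' B →
        |ζ x * (DV (P := PV d ℓ m K hd hL) ν cf * onFun (GE (domT hN D hk) hcf hw)) μ x -
            ζ x' * (DV (P := PV d ℓ m K hd hL) ν cf * onFun (GE (domT hN D hk) hcf hw)) μ x'| ≤
          A * (Z₀ * (((supDist x.src x'.src : ℕ) : ℝ) / (((ℓ + 1 : ℕ) : ℝ)) ^ (blkV1 hN D x).1.1) ^ α + Zd) *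
            ((geomT D).len (blkV1 hN D x) * |cf|⁻¹) * Real.exp (-(delta3 β (2 * σ) * (geomT D).dist (blkV1 hN D x) y')) * B := by
  obtain ⟨ρH, hρH, hlegs⟩ := holderLegs_kLevel d ℓ hd hL hb₀ hb₁
  obtain ⟨σ₁, hσ₁, -, h⟩ := prop26_2137_grad_kLevel_cutoff_of_legs d ℓ hd hL hb₀ hb₁ hρH
  refine ⟨σ₁, hσ₁, fun σ hσ hσ1 β hβ hβ1 α hα0 hα1 => ?_⟩
  obtain ⟨A, M₂, hA, hM₂, h2⟩ := h σ hσ hσ1 β hβ hβ1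
  obtain ⟨CH, hCH, hlegs'⟩ := hlegs α hα0 hα1
  refine ⟨A * max CH 1, M₂, mul_nonneg hA (le_max_of_le_right zero_le_one), hM₂, ?_⟩
  intro m K Mh k R P' hN D hk hk2 a hMha hM8 hR2 hP5 hℓ hpl hM cf hcf w hw hwb ν x x' hdir hs1 hs2 ζ Z₀ Zd hZ₀ hZd y' μ B hμ
  set tα : ℝ := (((supDist x.src x'.src : ℕ) : ℝ) / (((ℓ + 1 : ℕ) : ℝ)) ^ (blkV1 hN D x).1.1) ^ α with htα
  have htα0 : 0 ≤ tα := Real.rpow_nonneg (by positivity) _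
  have hlen0 : ∀ y : (geomT D).Site, 0 ≤ (geomT D).len y * |cf|⁻¹ := fun y => by rw [geomT_len]; positivity
  have hPw : ∀ y : (geomT D).Site, 0 ≤ tα * ((geomT D).len y * |cf|⁻¹) := fun y => mul_nonneg htα0 (hlen0 y)
  obtain ⟨-, hres⟩ := h2 m K hN D hk hk2 hMha hM8 hR2 hP5 hℓ hpl hM hcf hw hwb
  have hb := hres ν x x' CH (fun y => tα * ((geomT D).len y * |cf|⁻¹)) hCH hPw
    (fun c => hlegs' m K hN D hk hMha hM8 hR2 hP5 hℓ c (hpl c) w hcf ν x x' hdir hs1 hs2) ζ Z₀ Zd hZ₀ hZd y' μ B hμ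
  refine hb.trans ?_
  have hZ₀0 : 0 ≤ Z₀ := (abs_nonneg _).trans hZ₀
  have hZd0 : 0 ≤ Zd := (abs_nonneg _).trans hZd
  have hB := hμ.nonneg
  have hE := Real.exp_nonneg (-(delta3 β (2 * σ) * (geomT D).dist (blkV1 hN D x) y'))
  have hq := hlen0 (blkV1 hN D x)
  have hm1 : CH ≤ max CH 1 := le_max_left _ _
  have hm2 : (1 : ℝ) ≤ max CH 1 := le_max_right _ _
  have hkey : Z₀ * (A * CH * (tα * ((geomT D).len (blkV1 hN D x) * |cf|⁻¹))) + Zd * (A * ((geomT D).len (blkV1 hN D x) * |cf|⁻¹)) ≤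
      A * max CH 1 * (Z₀ * tα + Zd) * ((geomT D).len (blkV1 hN D x) * |cf|⁻¹) := by
    have h1 : Z₀ * (A * CH * (tα * ((geomT D).len (blkV1 hN D x) * |cf|⁻¹))) ≤
        Z₀ * (A * max CH 1 * (tα * ((geomT D).len (blkV1 hN D x) * |cf|⁻¹))) := by gcongr
    have h2 : Zd * (A * ((geomT D).len (blkV1 hN D x) * |cf|⁻¹)) ≤ Zd * (A * max CH 1 * ((geomT D).len (blkV1 hN D x) * |cf|⁻¹)) := by
      have : A ≤ A * max CH 1 := le_mul_of_one_le_right hA hm2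
      gcongr
    calc _ ≤ Z₀ * (A * max CH 1 * (tα * ((geomT D).len (blkV1 hN D x) * |cf|⁻¹))) +
          Zd * (A * max CH 1 * ((geomT D).len (blkV1 hN D x) * |cf|⁻¹)) := add_le_add h1 h2
      _ = A * max CH 1 * (Z₀ * tα + Zd) * ((geomT D).len (blkV1 hN D x) * |cf|⁻¹) := by ring
  exact mul_le_mul_of_nonneg_right (mul_le_mul_of_nonneg_right hkey hE) hB

end Cutoff

end

end Literature.MathematicalPhysics.QuantumFieldTheory.Balaban1983to89.B6Ineq2137GradKLevelV1
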